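import Mathlib
import HarnessLib
import Summits.AtomisticToContinuum.FouriersLaw.Theses.OddSectorIrreversibility

/-!
# Sketch — crux-ideate stmt-AtomisticToContinuum-15159 (`OddSectorIrreversibility.TapLeakBound`, P), ideator 2, round 1

First lemmas of the idea card `drain-convexity-second-tap-identity` (defs only + two tiny sanity
theorems; nothing here is a skeleton).  Notation: `𝒩_b f = -(T ∂²_{p_b} f) + p_b ∂_{p_b} f` (the
Ornstein–Uhlenbeck tap operator; the bath part of the generator is `S = -γ Σ_b 𝒩_b`),
`μ_T = e^{-H_N/T} dq dp` (unnormalised Gibbs weight, mass `Z`), `J = Σ_k j_k`, `u` the Kubo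
corrector (`L u = -J`), `Y_b := ∂_{p_b} - γ⁻¹ ∂_{q_b}` (derivative at fixed OVERDAMPED contact
coordinate `z_b = q_b + p_b/γ`).
-/

namespace Summit.AtomisticToContinuum.FouriersLaw.Cruxes.TapLeakBound.DrainConvexity

open MeasureTheory
open Literature.MathematicalPhysics.KineticTheory.HeatConduction

noncomputable section

/-- The Ornstein–Uhlenbeck tap operator at site `b`: `𝒩_b f = -(T ∂_{p_b}∂_{p_b} f) + p_b ∂_{p_b} f`. -/
def bathOp {N : ℕ} (T : ℝ) (b : Fin N) (f : PhaseSpace N → ℝ) (x : PhaseSpace N) : ℝ :=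
  -(T * partialP b (partialP b f) x) + x.2 b * partialP b f x

/-- The overdamped-contact derivative `Y_b f = ∂_{p_b} f - γ⁻¹ ∂_{q_b} f`. -/
def overdampedDeriv {N : ℕ} (γ : ℝ) (b : Fin N) (f : PhaseSpace N → ℝ) (x : PhaseSpace N) : ℝ :=
  partialP b f x - γ⁻¹ * partialQ b f x

/-- Growth class making every Gaussian / Liouville integration by parts below legitimate at fixed
`N`: derivatives of order `≤ 3` bounded by `C e^{θ H}` with `2θ < 1/T` (the Cuneo–Eckmann–Hairer–
Rey-Bellet weighted class in which the fixed-`N` corrector lives). -/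
def ExpWeightGrowth {N : ℕ} (H : PhaseSpace N → ℝ) (T : ℝ) (u : PhaseSpace N → ℝ) : Prop :=
  ∃ θ C : ℝ, 2 * θ < 1 / T ∧ ∀ k : ℕ, k ≤ 3 → ∀ x : PhaseSpace N,
    ‖iteratedFDeriv ℝ k u x‖ ≤ C * Real.exp (θ * H x)

/-- **FIRST LEMMA (fixed `N`, exact) — the SECOND-ORDER TAP IDENTITY.**  Pair the corrector
equation `L u = -J` with `𝒩_b u` in `L²(μ_T)`: the antisymmetric Liouville part gives the MIXED tap
correlation through `[∂_{p_b}, A] = ∂_{q_b}` and `⟨A g, g⟩_{μ_T} = 0`; the bath part gives the Gram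
matrix of the two tap operators; the source gives a LOCAL term (`∂_{p_b} J = ∂_{p_b} j_b`):
`γ (⟨𝒩_{b₀}u, 𝒩_{b₀}u⟩ + ⟨𝒩_{b₁}u, 𝒩_{b₀}u⟩) = T ⟨∂_{q_{b₀}}u, ∂_{p_{b₀}}u⟩ + T ⟨∂_{p_{b₀}}J, ∂_{p_{b₀}}u⟩`
(all pairings in `L²(e^{-H/T})`; for `N = 1`, `b₀ = b₁` and the left side is `2γ‖𝒩_0 u‖²`, matching
the doubled bath term of `OscillatorChain.generator`).  Harmonic member: verified to `1e-15` for
`N = 3 … 64` by exact Lyapunov algebra (kit j016207).  This is `-¼ d²/dτ² ‖P_τ u‖²|_{τ=0}` rewritten: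
the convexity defect of the tap drain. -/
def SecondTapIdentity : Prop :=
  ∀ ω₂ lam β γ : ℝ, 0 < ω₂ → 0 < lam → 0 < β → 0 < γ → ∀ T : ℝ, 0 < T →
    ∀ (N : ℕ) (b₀ b₁ : Fin N) (u : PhaseSpace N → ℝ), b₀.val = 0 → b₁.val = N - 1 →
    let P := pinnedChain ω₂ lam β γ
    let μT : Measure (PhaseSpace N) :=
      volume.withDensity (fun x => ENNReal.ofReal (Real.exp (-(P.hamiltonian N x) / T)))
    let J : PhaseSpace N → ℝ := fun z => ∑ k : Fin N, P.bondCurrent N k z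
    ContDiff ℝ 3 u → ExpWeightGrowth (P.hamiltonian N) T u →
    (∀ x, P.generator N T T u x = -J x) →
    γ * ((∫ x, bathOp T b₀ u x * bathOp T b₀ u x ∂μT) + ∫ x, bathOp T b₁ u x * bathOp T b₀ u x ∂μT)
      = T * (∫ x, partialQ b₀ u x * partialP b₀ u x ∂μT)
        + T * ∫ x, partialP b₀ J x * partialP b₀ u x ∂μT

/-- Gram positivity of the two commuting, nonnegative tap operators: `⟨𝒩_{b₁}u, 𝒩_{b₀}u⟩ ≥ 0`
(`𝒩_{b₀}`, `𝒩_{b₁}` act on different Gaussian coordinates; `⟨𝒩_{b₁}u, 𝒩_{b₀}u⟩ = ‖𝒩_{b₀}^{1/2}𝒩_{b₁}^{1/2}u‖²`).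
With `SecondTapIdentity` it gives `γ ‖𝒩_{b₀}u‖² ≤ T⟨∂_{q_{b₀}}u, ∂_{p_{b₀}}u⟩ + T⟨∂_{p_{b₀}}J, ∂_{p_{b₀}}u⟩`. -/
def TapGramPositivity : Prop :=
  ∀ ω₂ lam β γ : ℝ, 0 < ω₂ → 0 < lam → 0 < β → 0 < γ → ∀ T : ℝ, 0 < T →
    ∀ (N : ℕ) (b₀ b₁ : Fin N) (u : PhaseSpace N → ℝ), b₀.val = 0 → b₁.val = N - 1 →
    let P := pinnedChain ω₂ lam β γ
    let μT : Measure (PhaseSpace N) :=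
      volume.withDensity (fun x => ENNReal.ofReal (Real.exp (-(P.hamiltonian N x) / T)))
    ContDiff ℝ 3 u → ExpWeightGrowth (P.hamiltonian N) T u →
    0 ≤ ∫ x, bathOp T b₁ u x * bathOp T b₀ u x ∂μT

/-- **TRANSFER TARGET `C⁺` (replaces H1 = `BoundaryHermiteRegularity` on the corrector side of the
filed split `P ⇐ H1 ∧ C′`): ONE-SIDED MIXED TAP BOUND.**  For the Kubo corrector `u = u_N`
(characterised verbatim as in `TapLeakBound`), the position–momentum tap correlation at a contact
is at most the first-order tap budget: `T ∫ ∂_{q_b}u · ∂_{p_b}u dμ_T ≤ C (|∫ u J dμ_T| + Z)`,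
`N`-uniformly.  (It is automatically `≥ -O(√(Z ∫uJ))` by `SecondTapIdentity` + `TapGramPositivity`,
so only the upper bound has content.)  Harmonic member: `T⟨∂_q u, ∂_p u⟩/⟨u,J⟩ → 0.62` (kit j016207). -/
def MixedTapBound : Prop :=
  ∀ ω₂ lam β γ : ℝ, 0 < ω₂ → 0 < lam → 0 < β → 0 < γ → ∀ T : ℝ, 0 < T → ∃ C : ℝ,
    ∀ (N : ℕ) (b : Fin N) (u : PhaseSpace N → ℝ), (b.val = 0 ∨ b.val = N - 1) →
    let P := pinnedChain ω₂ lam β γ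
    let μT : Measure (PhaseSpace N) :=
      volume.withDensity (fun x => ENNReal.ofReal (Real.exp (-(P.hamiltonian N x) / T)))
    let J : PhaseSpace N → ℝ := fun z => ∑ k : Fin N, P.bondCurrent N k z
    ContDiff ℝ 3 u → MemLp u 2 μT →
    (∀ᵐ x ∂μT, Filter.Tendsto (fun τ : ℝ => ∫ t in Set.Ioc (0 : ℝ) τ,
        (∫ y, J y ∂(P.transitionKernel N T T t.toNNReal x))) Filter.atTop (nhds (u x))) →
    MemLp (partialQ b u) 2 μT ∧
    T * ∫ x, partialQ b u x * partialP b u x ∂μT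
      ≤ C * (|∫ x, u x * J x ∂μT| + ∫ x, Real.exp (-(P.hamiltonian N x) / T) ∂volume)

/-- H1 restated locally (the child `BoundaryHermiteRegularity` of the filed split lives in the
planner's children.json, not in the route file): `‖𝒩_b u⁺‖²_{μ_T} ≤ C (|∫uJ| + Z)` for the
corrector, `u⁺ = (u + u∘Θ)/2`. -/
def BoundaryHermiteRegularityLocal : Prop :=
  ∀ ω₂ lam β γ : ℝ, 0 < ω₂ → 0 < lam → 0 < β → 0 < γ → ∀ T : ℝ, 0 < T → ∃ C : ℝ,
    ∀ (N : ℕ) (b : Fin N) (u : PhaseSpace N → ℝ), (b.val = 0 ∨ b.val = N - 1) →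
    let P := pinnedChain ω₂ lam β γ
    let μT : Measure (PhaseSpace N) :=
      volume.withDensity (fun x => ENNReal.ofReal (Real.exp (-(P.hamiltonian N x) / T)))
    let J : PhaseSpace N → ℝ := fun z => ∑ k : Fin N, P.bondCurrent N k z
    let ue : PhaseSpace N → ℝ := fun x => (u x + u (x.1, -x.2)) / 2
    ContDiff ℝ 3 u → MemLp u 2 μT →
    (∀ᵐ x ∂μT, Filter.Tendsto (fun τ : ℝ => ∫ t in Set.Ioc (0 : ℝ) τ,
        (∫ y, J y ∂(P.transitionKernel N T T t.toNNReal x))) Filter.atTop (nhds (u x))) →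
    MemLp (bathOp T b ue) 2 μT ∧
    ∫ x, (bathOp T b ue x) ^ 2 ∂μT
      ≤ C * (|∫ x, u x * J x ∂μT| + ∫ x, Real.exp (-(P.hamiltonian N x) / T) ∂volume)

/-- The reduction this card files (glue = `SecondTapIdentity` + `TapGramPositivity` + parity
`‖𝒩_b u⁺‖ ≤ ‖𝒩_b u‖` + the LANDED first-order tap identity `γTΣ_b‖∂_b u‖² = ∫uJ` + Cauchy–Schwarz on
the local term): the one-sided mixed bound implies H1. -/
def DrainConvexityReduction : Prop :=
  SecondTapIdentity → TapGramPositivity → MixedTapBound → BoundaryHermiteRegularityLocal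

/-- **Second lemma (fixed `N`, exact) — the OVERDAMPED RESOLVENT IDENTITY.**  With
`Y_b = ∂_{p_b} - γ⁻¹∂_{q_b}` one has `[Y_b, L] = -γ Y_b + γ⁻¹ Σ_k (∂_{q_b}∂_{q_k}H) ∂_{p_k}`, hence for
the corrector `(γ - L)(Y_b u) = Y_b J + γ⁻¹ Σ_k H_{q_b q_k} ∂_{p_k} u` pointwise (only `k ∈ {b, b±1}`
survive: `H_{q_bq_b} = ω₂ + 3 lam q_b² + Σ V''`, `H_{q_b q_{b±1}} = -V''(r)`); `N ≥ 2` so that the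
two baths sit on distinct sites (for `N = 1` the generator doubles the friction at site `0` and the
identity holds with `2γ` in place of `γ`).  The friction is what
puts the spectral parameter `γ > 0` on the left: `(γ - L)⁻¹` is a contraction by `1/γ` on `L²(μ_T)`
for EVERY `N` (`ResolventContraction`), so `‖Y_b u‖ ≤ γ⁻¹‖Y_bJ‖ + γ⁻²‖H_{q_bq_b}∂_{p_b}u‖ + γ⁻²‖V''∂_{p_{b±1}}u‖`
and `T⟨∂_{q_b}u, ∂_{p_b}u⟩ = γT‖∂_{p_b}u‖² - γT⟨Y_b u, ∂_{p_b}u⟩ ≤ ∫uJ + γT‖Y_b u‖‖∂_{p_b}u‖`. -/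
def OverdampedResolventIdentity : Prop :=
  ∀ ω₂ lam β γ : ℝ, 0 < ω₂ → 0 < lam → 0 < β → 0 < γ → ∀ T : ℝ, 0 < T →
    ∀ (N : ℕ) (b : Fin N) (u : PhaseSpace N → ℝ), 2 ≤ N → (b.val = 0 ∨ b.val = N - 1) →
    let P := pinnedChain ω₂ lam β γ
    let J : PhaseSpace N → ℝ := fun z => ∑ k : Fin N, P.bondCurrent N k z
    ContDiff ℝ 3 u → (∀ x, P.generator N T T u x = -J x) →
    ∀ x, γ * overdampedDeriv γ b u x - P.generator N T T (overdampedDeriv γ b u) x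
      = overdampedDeriv γ b J x
        + γ⁻¹ * ∑ k : Fin N, partialQ b (partialQ k (P.hamiltonian N)) x * partialP k u x

/-- `(γ - L)⁻¹` contracts by `1/γ` on `L²(μ_T)`, uniformly in `N` (dissipativity of `L`: the
Liouville part is `μ_T`-antisymmetric, the bath part nonpositive). Stated for classical solutions
in the growth class. -/
def ResolventContraction : Prop :=
  ∀ ω₂ lam β γ : ℝ, 0 < ω₂ → 0 < lam → 0 < β → 0 < γ → ∀ T : ℝ, 0 < T →
    ∀ (N : ℕ) (f g : PhaseSpace N → ℝ),
    let P := pinnedChain ω₂ lam β γ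
    let μT : Measure (PhaseSpace N) :=
      volume.withDensity (fun x => ENNReal.ofReal (Real.exp (-(P.hamiltonian N x) / T)))
    ContDiff ℝ 2 g → ExpWeightGrowth (P.hamiltonian N) T g → MemLp f 2 μT →
    (∀ x, γ * g x - P.generator N T T g x = f x) →
    ∫ x, (g x) ^ 2 ∂μT ≤ γ⁻¹ ^ 2 * ∫ x, (f x) ^ 2 ∂μT

/-- **Residual (R1) — WEIGHTED TAP BUDGET**: the landed first-order budget `γTΣ‖∂_b u‖² = ∫uJ`
survives the local stiffness weight `H_{q_bq_b} = ω₂ + 3 lam q_b² + V''(r)` (a Gibbs-sub-Gaussian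
variable of the contact neighbourhood). -/
def WeightedTapBudget : Prop :=
  ∀ ω₂ lam β γ : ℝ, 0 < ω₂ → 0 < lam → 0 < β → 0 < γ → ∀ T : ℝ, 0 < T → ∃ C : ℝ,
    ∀ (N : ℕ) (b : Fin N) (u : PhaseSpace N → ℝ), (b.val = 0 ∨ b.val = N - 1) →
    let P := pinnedChain ω₂ lam β γ
    let μT : Measure (PhaseSpace N) :=
      volume.withDensity (fun x => ENNReal.ofReal (Real.exp (-(P.hamiltonian N x) / T)))
    let J : PhaseSpace N → ℝ := fun z => ∑ k : Fin N, P.bondCurrent N k z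
    ContDiff ℝ 3 u → MemLp u 2 μT →
    (∀ᵐ x ∂μT, Filter.Tendsto (fun τ : ℝ => ∫ t in Set.Ioc (0 : ℝ) τ,
        (∫ y, J y ∂(P.transitionKernel N T T t.toNNReal x))) Filter.atTop (nhds (u x))) →
    ∫ x, (partialQ b (partialQ b (P.hamiltonian N)) x * partialP b u x) ^ 2 ∂μT
      ≤ C * (|∫ x, u x * J x ∂μT| + ∫ x, Real.exp (-(P.hamiltonian N x) / T) ∂volume)

/-- **Residual (R2) — NEIGHBOUR TAP SENSITIVITY** (the named residual of the line; first order,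
no identity budgets it — no friction at `b±1`): the corrector's sensitivity to the momentum of the
contact's NEIGHBOUR, stiffness-weighted, is at most the tap scale:
`∫ (V''(r_b) ∂_{p_{b'}}u)² dμ_T ≤ C(|∫uJ| + Z)` for `b' = b ± 1` the interior neighbour.  Harmonic
member: `γT‖∂_{p_1}u‖²/∫uJ → 2.3` (kit j016207, N ≤ 64).  Cheapest falsifier of the whole card:
the replica finite-difference estimator of this ratio vs `N` at the anharmonic benchmark points
(kit job queued by this seat). -/
def NeighbourTapSensitivity : Prop :=
  ∀ ω₂ lam β γ : ℝ, 0 < ω₂ → 0 < lam → 0 < β → 0 < γ → ∀ T : ℝ, 0 < T → ∃ C : ℝ,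
    ∀ (N : ℕ) (b b' : Fin N) (u : PhaseSpace N → ℝ),
    ((b.val = 0 ∧ b'.val = 1) ∨ (b.val = N - 1 ∧ b'.val = N - 2)) →
    let P := pinnedChain ω₂ lam β γ
    let μT : Measure (PhaseSpace N) :=
      volume.withDensity (fun x => ENNReal.ofReal (Real.exp (-(P.hamiltonian N x) / T)))
    let J : PhaseSpace N → ℝ := fun z => ∑ k : Fin N, P.bondCurrent N k z
    ContDiff ℝ 3 u → MemLp u 2 μT →
    (∀ᵐ x ∂μT, Filter.Tendsto (fun τ : ℝ => ∫ t in Set.Ioc (0 : ℝ) τ,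
        (∫ y, J y ∂(P.transitionKernel N T T t.toNNReal x))) Filter.atTop (nhds (u x))) →
    ∫ x, (partialQ b (partialQ b' (P.hamiltonian N)) x * partialP b' u x) ^ 2 ∂μT
      ≤ C * (|∫ x, u x * J x ∂μT| + ∫ x, Real.exp (-(P.hamiltonian N x) / T) ∂volume)

/-- The whole corrector-side line of the card, as one implication to be composed by a crux-plan
seat (NOT claimed here): exact identities + contraction + the two first-order residuals ⇒ the
mixed bound ⇒ H1; with the flow-side child `C′ = ResampledKickCone` and the filed Gaussian-IBP glue
this re-routes `TapLeakBound`. -/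
def CorrectorSideLine : Prop :=
  SecondTapIdentity → TapGramPositivity → OverdampedResolventIdentity → ResolventContraction →
    WeightedTapBudget → NeighbourTapSensitivity → MixedTapBound

/-! Two sanity checks that the local operators unfold as intended. -/

theorem bathOp_def {N : ℕ} (T : ℝ) (b : Fin N) (f : PhaseSpace N → ℝ) (x : PhaseSpace N) :
    bathOp T b f x = -(T * partialP b (partialP b f) x) + x.2 b * partialP b f x := rfl

theorem overdampedDeriv_def {N : ℕ} (γ : ℝ) (b : Fin N) (f : PhaseSpace N → ℝ) (x : PhaseSpace N) :
    overdampedDeriv γ b f x = partialP b f x - γ⁻¹ * partialQ b f x := rfl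

/-- The typed crux is visible from here (the card serves it through the filed split). -/
example : Prop := Summit.AtomisticToContinuum.FouriersLaw.Theses.OddSectorIrreversibility.TapLeakBound

end

end Summit.AtomisticToContinuum.FouriersLaw.Cruxes.TapLeakBound.DrainConvexity
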